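import Summits.QuantumFields.YangMills.Theorems.ColdStartUniversalityLatticeLangevinHopfLaxDualTalagrand
import Summits.QuantumFields.YangMills.Theorems.ColdStartUniversalityLatticeLangevinTalagrandDual
import Summits.QuantumFields.YangMills.Theorems.ColdStartUniversalityWilsonLogSobolevEnergyForm
import Summits.QuantumFields.YangMills.Theorems.ColdStartUniversalityLatticeLangevinLocalGradientBound
import Summits.QuantumFields.YangMills.Theorems.ColdStartUniversalityShenZhuZhuW2DiracContractionSU2
import HarnessLib

/-!
# TALAGRAND'S TRANSPORT INEQUALITY `T₂` FOR THE `SU(2)` WILSON–GIBBS MEASURE on `(ℤ/L)³` at `|β'| < 1/12`, uniformly in the volume: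
# `W₂^{ρ_L}(ν, μ_(β'))² ≤ (2/(1 − 12|β'|))·KL(ν ‖ μ_(β'))` for EVERY probability measure `ν` (Otto–Villani from the volume-uniform log-Sobolev inequality)

Seat `ym-line-csu-p1` (g42), route `ColdStartUniversality` of `Summits/QuantumFields/YangMills`, helper file G70b (`--supports stmt-QuantumFields-24809`).
The energy-form log-Sobolev inequality of G70a is extended to `e^F` for `ρ_L`-LIPSCHITZ `F` with LOCAL Lipschitz majorants (mollification with local
carré control, G63c `exists_smooth_approx_local_carre`; chain rule `Γ^A(e^{g/2}) = e^g Γ^A(g)/4`; dominated convergence), and fed into the generic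
Otto–Villani machine of G69a–d (Hopf–Lax hypercontractivity ⇒ dual `T₂` ⇒ `T₂` by the Gibbs variational principle and Kantorovich duality) on the
compact metric space `(SU(2)^E, ρ_L)`:

* ★★★ `wilson_logSobolev_exp_local` — for `F` `ρ_L`-Lipschitz and `G(w)`-Lipschitz on each ball `{ρ_L(w,·) ≤ R}` (`G` u.s.c., `0 ≤ G ≤ M`), `μ = μ_(β')`:
  `∫F e^F dμ − (∫e^F dμ) log ∫e^F dμ ≤ ((1/(1−12|β'|))/2)·∫G² e^F dμ`;
* ★★★ `wilson_integral_exp_hopfLax_le` — the dual `T₂`: `∫ exp(inf_v [f(v) + ρ_L(·,v)²/(2C)]) dμ_(β') ≤ exp(∫f dμ_(β'))`, `C = 1/(1−12|β'|)`, `f` Lipschitz;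
* ★★★★ **`wilson_talagrand_T2`** — `szzWassersteinSq ρ_L² ν μ_(β') ≤ ofReal(2C·KL(ν‖μ_(β')))`, `C = 1/(1−12|β'|)`, for every probability `ν` with
  `KL(ν‖μ_(β')) < ∞` — Talagrand's `T₂(1/(1−12|β'|))` for the Wilson–Gibbs law, the same constant for every `L`.

THEOREMS ONLY, no definition, no sorry.  HONEST FRAMING: fixed cut-off, finite volume, high temperature `|β'| < 1/12`; "uniform" = the constant does
not depend on `L`; nothing `K`-uniform along the route's scaling; `UniformColdStartMixing` (24809, ASIDE) is not restated; no crux, rung or summit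
statement is proved; the Yang–Mills mass gap is NOT proved.
-/

set_option autoImplicit false

noncomputable section

namespace Summit.QuantumFields.YangMills.Theorems.ColdStartUniversality

open MeasureTheory ProbabilityTheory Matrix Complex Finset Filter Topology Set Metric InformationTheory
open scoped ComplexConjugate BigOperators NNReal ENNReal
open Literature.Probability.Process Literature.MathematicalPhysics.QuantumFieldTheory
open Literature.MathematicalPhysics.QuantumLattice (fundamentalRep fundamentalLatticeRep continuous_fundamentalRep fundamentalRep_apply fundamentalLatticeRep_N)

variable {L : ℕ} [NeZero L]

/-! ## §3. The log-Sobolev inequality for `e^F`, `F` Lipschitz, with local Lipschitz majorants -/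

/-- ★★★ **Log-Sobolev inequality for Lipschitz exponentials with local data.**  For `|β'| < 1/12`, every `L`, `F : SU(2)^E → ℝ` `L_F`-Lipschitz for `ρ_L`
and `G(w)`-Lipschitz on each ball `{ρ_L(w,·) ≤ R}` (`G` upper semicontinuous, `0 ≤ G ≤ M`), with `μ = μ_(β')`:
`∫F e^F dμ − (∫e^F dμ) log ∫e^F dμ ≤ ((1/(1−12|β'|))/2)·∫G² e^F dμ` (§1 for the mollified `e^{g_r/2}`, §2, G63c, dominated convergence `r → 0`).
[cite: ShenZhuZhu2022, §4 Theorem 4.2 and Corollary 4.4 (4.12)] -/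
theorem wilson_logSobolev_exp_local (L : ℕ) [NeZero L] (β' : ℝ) (hβ : |β'| < 1 / 12)
    {F : GaugeConfig 3 L (Matrix.specialUnitaryGroup (Fin 2) ℂ) → ℝ} {Lf : ℝ} (hLf : 0 ≤ Lf)
    (hlip : ∀ Q Q', |F Q' - F Q| ≤ Lf * Real.sqrt (torusRiemannDistSq (fundamentalLatticeRep 2) Q Q'))
    {R : ℝ} (hR : 0 < R) {G : GaugeConfig 3 L (Matrix.specialUnitaryGroup (Fin 2) ℂ) → ℝ} (hGusc : UpperSemicontinuous G) {M : ℝ}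
    (hG0 : ∀ w, 0 ≤ G w) (hGM : ∀ w, G w ≤ M)
    (hloc : ∀ w z' z'' : GaugeConfig 3 L (Matrix.specialUnitaryGroup (Fin 2) ℂ),
      Real.sqrt (torusRiemannDistSq (fundamentalLatticeRep 2) w z') ≤ R → Real.sqrt (torusRiemannDistSq (fundamentalLatticeRep 2) w z'') ≤ R →
        |F z'' - F z'| ≤ G w * Real.sqrt (torusRiemannDistSq (fundamentalLatticeRep 2) z' z'')) :
    ∫ x, F x * Real.exp (F x) ∂(wilsonMeasure (d := 3) (L := L) (fundamentalRep (Fin 2)) β') -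
        (∫ x, Real.exp (F x) ∂(wilsonMeasure (d := 3) (L := L) (fundamentalRep (Fin 2)) β')) *
          Real.log (∫ x, Real.exp (F x) ∂(wilsonMeasure (d := 3) (L := L) (fundamentalRep (Fin 2)) β')) ≤
      (1 / (1 - 12 * |β'|)) / 2 * ∫ x, G x ^ 2 * Real.exp (F x) ∂(wilsonMeasure (d := 3) (L := L) (fundamentalRep (Fin 2)) β') := by
  let coords : GaugeConfig 3 L (Matrix.specialUnitaryGroup (Fin 2) ℂ) → (Edge 3 L × Fin 2 × Fin 2 × Bool → ℝ) :=
    fun V q => (fun z : ℂ => if q.2.2.2 then z.im else z.re) ((fundamentalRep (Fin 2) (V q.1) : Matrix (Fin 2) (Fin 2) ℂ) q.2.1 q.2.2.1)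
  let A : GaugeConfig 3 L (Matrix.specialUnitaryGroup (Fin 2) ℂ) → (Edge 3 L × Fin 2 × Fin 2 × Bool) →
      (Edge 3 L × Fin 2 × Fin 2 × Bool) → ℝ := fun V i j =>
    ∑ n : Edge 3 L × NoiseIdx 2,
      (if n.1 = i.1 then (fun z : ℂ => if i.2.2.2 then z.im else z.re)
        ((latticeLangevinDynamics (fundamentalLatticeRep 2) β').noise
          (matrixConfig (fundamentalRep (Fin 2)) V) i.1 n.2 i.2.1 i.2.2.1) else 0) *
      (if n.1 = j.1 then (fun z : ℂ => if j.2.2.2 then z.im else z.re)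
        ((latticeLangevinDynamics (fundamentalLatticeRep 2) β').noise
          (matrixConfig (fundamentalRep (Fin 2)) V) j.1 n.2 j.2.1 j.2.2.1) else 0)
  classical
  haveI := secondCountableTopology_su2
  haveI := borelSpace_config L
  haveI : IsProbabilityMeasure (wilsonMeasure (d := 3) (L := L) (fundamentalRep (Fin 2)) β') :=
    isProbabilityMeasure_wilsonMeasure (d := 3) (L := L) (fundamentalRep (Fin 2)) (continuous_fundamentalRep (Fin 2)) β'
  obtain ⟨μ, hμ⟩ : ∃ μ : Measure (GaugeConfig 3 L (Matrix.specialUnitaryGroup (Fin 2) ℂ)), μ = wilsonMeasure (d := 3) (L := L) (fundamentalRep (Fin 2)) β' := ⟨_, rfl⟩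
  haveI : IsProbabilityMeasure μ := by rw [hμ]; infer_instance
  rw [← hμ]
  have hc : 0 < 1 - 12 * |β'| := by linarith
  have hco : Continuous coords := continuous_coords (L := L)
  have hFc : Continuous F := continuous_of_riemannLipschitz hlip
  obtain ⟨MF, hMF'⟩ := (isCompact_range (continuous_abs.comp hFc)).bddAbove
  have hMF : ∀ x, |F x| ≤ MF := fun x => hMF' ⟨x, rfl⟩
  have hGm : Measurable G := hGusc.measurable
  -- the radii `r_n`
  obtain ⟨E, hE⟩ : ∃ E : ℝ, E = Real.sqrt (Fintype.card (Edge 3 L)) := ⟨_, rfl⟩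
  have hE0 : 0 ≤ E := by rw [hE]; exact Real.sqrt_nonneg _
  obtain ⟨r₀, hr₀⟩ : ∃ r₀ : ℝ, r₀ = min (1 / 4) (R / (12 * E + 1)) := ⟨_, rfl⟩
  have hr₀0 : 0 < r₀ := by rw [hr₀]; exact lt_min (by norm_num) (div_pos hR (by positivity))
  have hr₀4 : r₀ ≤ 1 / 4 := by rw [hr₀]; exact min_le_left _ _
  have hr₀R : 12 * E * r₀ < R := by
    have h1 : r₀ ≤ R / (12 * E + 1) := by rw [hr₀]; exact min_le_right _ _
    have h2 : 12 * E * (R / (12 * E + 1)) < R := by rw [mul_div_assoc', div_lt_iff₀ (by positivity)]; nlinarith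
    nlinarith [mul_le_mul_of_nonneg_left h1 (by positivity : (0:ℝ) ≤ 12 * E)]
  have hrn0 : ∀ n : ℕ, 0 < r₀ / ((n : ℝ) + 2) := fun n => by positivity
  have hrn : ∀ n : ℕ, r₀ / ((n : ℝ) + 2) ≤ r₀ := fun n => div_le_self hr₀0.le (by linarith [(Nat.cast_nonneg n : (0:ℝ) ≤ n)])
  have hrn4 : ∀ n : ℕ, r₀ / ((n : ℝ) + 2) ≤ 1 / 4 := fun n => (hrn n).trans hr₀4
  have hrnR : ∀ n : ℕ, 12 * Real.sqrt (Fintype.card (Edge 3 L)) * (r₀ / ((n : ℝ) + 2)) < R := fun n => by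
    rw [← hE]; exact lt_of_le_of_lt (mul_le_mul_of_nonneg_left (hrn n) (by positivity)) hr₀R
  -- the approximants
  have happ : ∀ n : ℕ, ∃ g : (Edge 3 L × Fin 2 × Fin 2 × Bool → ℝ) → ℝ, ContDiff ℝ 5 g ∧
      (∀ P : GaugeConfig 3 L (Matrix.specialUnitaryGroup (Fin 2) ℂ), |g (coords P) - F P| ≤ Lf * (12 * Real.sqrt (Fintype.card (Edge 3 L)) * (r₀ / ((n : ℝ) + 2)))) ∧
      ∀ w : GaugeConfig 3 L (Matrix.specialUnitaryGroup (Fin 2) ℂ),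
        (∑ i : Edge 3 L × Fin 2 × Fin 2 × Bool, ∑ j : Edge 3 L × Fin 2 × Fin 2 × Bool,
          fderiv ℝ g (coords w) (Pi.single i 1) * fderiv ℝ g (coords w) (Pi.single j 1) * A w i j) ≤ 2 * (G w / (1 - 2 * (r₀ / ((n : ℝ) + 2)))) ^ 2 :=
    fun n => exists_smooth_approx_local_carre (L := L) β' hLf hlip hG0 hloc (hrn0 n) (hrn4 n) (hrnR n)
  choose g hg happr hgcarre using happ
  -- the LSI for each approximant `e^{g_n/2}`
  have hLSn : ∀ n : ℕ, ∫ x, g n (coords x) * Real.exp (g n (coords x)) ∂μ - (∫ x, Real.exp (g n (coords x)) ∂μ) * Real.log (∫ x, Real.exp (g n (coords x)) ∂μ) ≤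
      (1 / (1 - 12 * |β'|)) / 2 * ∫ x, (G x / (1 - 2 * (r₀ / ((n : ℝ) + 2)))) ^ 2 * Real.exp (g n (coords x)) ∂μ := by
    intro n
    have hfn : ContDiff ℝ 3 (fun y => Real.exp (g n y / 2)) := Real.contDiff_exp.comp (((hg n).of_le (by norm_num)).div_const 2)
    have h1 : (∫ V, Real.exp (g n (coords V) / 2) ^ 2 * Real.log (Real.exp (g n (coords V) / 2) ^ 2) ∂(wilsonMeasure (d := 3) (L := L) (fundamentalRep (Fin 2)) β')) -
        (∫ V, Real.exp (g n (coords V) / 2) ^ 2 ∂(wilsonMeasure (d := 3) (L := L) (fundamentalRep (Fin 2)) β')) *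
          Real.log (∫ V, Real.exp (g n (coords V) / 2) ^ 2 ∂(wilsonMeasure (d := 3) (L := L) (fundamentalRep (Fin 2)) β')) ≤
        1 / (1 - 12 * |β'|) * ∫ V, (∑ i : Edge 3 L × Fin 2 × Fin 2 × Bool, ∑ j : Edge 3 L × Fin 2 × Fin 2 × Bool,
          fderiv ℝ (fun y => Real.exp (g n y / 2)) (coords V) (Pi.single i 1) * fderiv ℝ (fun y => Real.exp (g n y / 2)) (coords V) (Pi.single j 1) * A V i j)
            ∂(wilsonMeasure (d := 3) (L := L) (fundamentalRep (Fin 2)) β') :=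
      wilson_entropy_le_integral_carre_uniform L β' hβ (fun y => Real.exp (g n y / 2)) hfn
    rw [← hμ] at h1
    have hsq : ∀ x : GaugeConfig 3 L (Matrix.specialUnitaryGroup (Fin 2) ℂ), Real.exp (g n (coords x) / 2) ^ 2 = Real.exp (g n (coords x)) := fun x => by
      rw [sq, ← Real.exp_add]; ring_nf
    have hl : ∀ x : GaugeConfig 3 L (Matrix.specialUnitaryGroup (Fin 2) ℂ), Real.exp (g n (coords x) / 2) ^ 2 * Real.log (Real.exp (g n (coords x) / 2) ^ 2) =
        g n (coords x) * Real.exp (g n (coords x)) := fun x => by rw [hsq, Real.log_exp, mul_comm]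
    have e1 : ∫ x, Real.exp (g n (coords x) / 2) ^ 2 * Real.log (Real.exp (g n (coords x) / 2) ^ 2) ∂μ = ∫ x, g n (coords x) * Real.exp (g n (coords x)) ∂μ :=
      integral_congr_ae (ae_of_all _ hl)
    have e2 : ∫ x, Real.exp (g n (coords x) / 2) ^ 2 ∂μ = ∫ x, Real.exp (g n (coords x)) ∂μ := integral_congr_ae (ae_of_all _ hsq)
    have hch : ∀ x : GaugeConfig 3 L (Matrix.specialUnitaryGroup (Fin 2) ℂ), (∑ i : Edge 3 L × Fin 2 × Fin 2 × Bool, ∑ j : Edge 3 L × Fin 2 × Fin 2 × Bool,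
        fderiv ℝ (fun y => Real.exp (g n y / 2)) (coords x) (Pi.single i 1) * fderiv ℝ (fun y => Real.exp (g n y / 2)) (coords x) (Pi.single j 1) * A x i j) =
        Real.exp (g n (coords x)) / 4 * (∑ i : Edge 3 L × Fin 2 × Fin 2 × Bool, ∑ j : Edge 3 L × Fin 2 × Fin 2 × Bool,
          fderiv ℝ (g n) (coords x) (Pi.single i 1) * fderiv ℝ (g n) (coords x) (Pi.single j 1) * A x i j) :=
      fun x => carre_exp_half β' ((hg n).differentiable (by norm_num)) x
    have e3 : ∫ x, (∑ i : Edge 3 L × Fin 2 × Fin 2 × Bool, ∑ j : Edge 3 L × Fin 2 × Fin 2 × Bool,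
        fderiv ℝ (fun y => Real.exp (g n y / 2)) (coords x) (Pi.single i 1) * fderiv ℝ (fun y => Real.exp (g n y / 2)) (coords x) (Pi.single j 1) * A x i j) ∂μ ≤
        ∫ x, Real.exp (g n (coords x)) / 4 * (2 * (G x / (1 - 2 * (r₀ / ((n : ℝ) + 2)))) ^ 2) ∂μ := by
      have hup : Integrable (fun x => Real.exp (g n (coords x)) / 4 * (2 * (G x / (1 - 2 * (r₀ / ((n : ℝ) + 2)))) ^ 2)) μ := by
        have hbd : ∀ x, Real.exp (g n (coords x)) / 4 * (2 * (G x / (1 - 2 * (r₀ / ((n : ℝ) + 2)))) ^ 2) ∈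
            Set.Icc (0 : ℝ) (Real.exp (MF + Lf * (12 * Real.sqrt (Fintype.card (Edge 3 L)) * r₀)) / 4 * (2 * (M / (1 - 2 * (r₀ / ((n : ℝ) + 2)))) ^ 2)) := by
          intro x
          have h12 : 0 < 1 - 2 * (r₀ / ((n : ℝ) + 2)) := by linarith [hrn4 n]
          refine ⟨by positivity, mul_le_mul ?_ ?_ (by positivity) (by positivity)⟩
          · refine div_le_div_of_nonneg_right (Real.exp_le_exp.2 ?_) (by norm_num)
            have ha := happr n x; have hb := hMF x
            rw [abs_le] at ha hb
            nlinarith [mul_le_mul_of_nonneg_left (hrn n) (by positivity : (0:ℝ) ≤ Lf * (12 * Real.sqrt (Fintype.card (Edge 3 L))))]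
          · have hGx : G x / (1 - 2 * (r₀ / ((n : ℝ) + 2))) ≤ M / (1 - 2 * (r₀ / ((n : ℝ) + 2))) := div_le_div_of_nonneg_right (hGM x) h12.le
            have hG0x : 0 ≤ G x / (1 - 2 * (r₀ / ((n : ℝ) + 2))) := div_nonneg (hG0 x) h12.le
            nlinarith
        have hmeas : Measurable fun x => Real.exp (g n (coords x)) / 4 * (2 * (G x / (1 - 2 * (r₀ / ((n : ℝ) + 2)))) ^ 2) :=
          ((Real.measurable_exp.comp ((hg n).continuous.measurable.comp hco.measurable)).div_const 4).mul (((hGm.div_const _).pow_const 2).const_mul 2)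
        exact (memLp_of_bounded (ae_of_all _ hbd) hmeas.aestronglyMeasurable 1).integrable le_rfl
      refine integral_mono_of_nonneg (ae_of_all _ fun x => ?_) hup (ae_of_all _ fun x => ?_)
      · show (0 : ℝ) ≤ (∑ i : Edge 3 L × Fin 2 × Fin 2 × Bool, ∑ j : Edge 3 L × Fin 2 × Fin 2 × Bool,
          fderiv ℝ (fun y => Real.exp (g n y / 2)) (coords x) (Pi.single i 1) * fderiv ℝ (fun y => Real.exp (g n y / 2)) (coords x) (Pi.single j 1) * A x i j)
        rw [hch x]
        have hnn : 0 ≤ (∑ i : Edge 3 L × Fin 2 × Fin 2 × Bool, ∑ j : Edge 3 L × Fin 2 × Fin 2 × Bool,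
            fderiv ℝ (g n) (coords x) (Pi.single i 1) * fderiv ℝ (g n) (coords x) (Pi.single j 1) * A x i j) := by
          have heq : (∑ i : Edge 3 L × Fin 2 × Fin 2 × Bool, ∑ j : Edge 3 L × Fin 2 × Fin 2 × Bool,
              fderiv ℝ (g n) (coords x) (Pi.single i 1) * fderiv ℝ (g n) (coords x) (Pi.single j 1) * A x i j) =
              ∑ m : Edge 3 L × NoiseIdx (fundamentalLatticeRep 2).N, (fderiv ℝ (g n) (coords x) (fun q : Edge 3 L × Fin (fundamentalLatticeRep 2).N × Fin (fundamentalLatticeRep 2).N × Bool =>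
                if m.1 = q.1 then (fun z : ℂ => if q.2.2.2 then z.im else z.re) (((Real.sqrt 2 : ℂ) • ((fundamentalLatticeRep 2).lieProj (noiseDir m.2) *
                  (fundamentalLatticeRep 2).ρ (x q.1))) q.2.1 q.2.2.1) else 0)) ^ 2 := carre_eq_sum_sq_frame_two β' (g n) x
          rw [heq]; exact Finset.sum_nonneg fun _ _ => sq_nonneg _
        exact mul_nonneg (div_nonneg (Real.exp_pos _).le (by norm_num)) hnn
      · show (∑ i : Edge 3 L × Fin 2 × Fin 2 × Bool, ∑ j : Edge 3 L × Fin 2 × Fin 2 × Bool,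
          fderiv ℝ (fun y => Real.exp (g n y / 2)) (coords x) (Pi.single i 1) * fderiv ℝ (fun y => Real.exp (g n y / 2)) (coords x) (Pi.single j 1) * A x i j) ≤
          Real.exp (g n (coords x)) / 4 * (2 * (G x / (1 - 2 * (r₀ / ((n : ℝ) + 2)))) ^ 2)
        rw [hch x]
        exact mul_le_mul_of_nonneg_left (hgcarre n x) (div_nonneg (Real.exp_pos _).le (by norm_num))
    have e4 : ∫ x, Real.exp (g n (coords x)) / 4 * (2 * (G x / (1 - 2 * (r₀ / ((n : ℝ) + 2)))) ^ 2) ∂μ =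
        (1 / 2) * ∫ x, (G x / (1 - 2 * (r₀ / ((n : ℝ) + 2)))) ^ 2 * Real.exp (g n (coords x)) ∂μ := by
      rw [← integral_const_mul]; exact integral_congr_ae (ae_of_all _ fun x => by ring)
    rw [e1, e2] at h1
    calc _ ≤ 1 / (1 - 12 * |β'|) * ∫ x, (∑ i : Edge 3 L × Fin 2 × Fin 2 × Bool, ∑ j : Edge 3 L × Fin 2 × Fin 2 × Bool,
        fderiv ℝ (fun y => Real.exp (g n y / 2)) (coords x) (Pi.single i 1) * fderiv ℝ (fun y => Real.exp (g n y / 2)) (coords x) (Pi.single j 1) * A x i j) ∂μ := h1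
      _ ≤ 1 / (1 - 12 * |β'|) * ((1 / 2) * ∫ x, (G x / (1 - 2 * (r₀ / ((n : ℝ) + 2)))) ^ 2 * Real.exp (g n (coords x)) ∂μ) := by
          rw [← e4]; exact mul_le_mul_of_nonneg_left e3 (by positivity)
      _ = _ := by ring
  -- limits `n → ∞`
  have hconv : ∀ x : GaugeConfig 3 L (Matrix.specialUnitaryGroup (Fin 2) ℂ), Tendsto (fun n : ℕ => g n (coords x)) atTop (𝓝 (F x)) := by
    intro x
    rw [Metric.tendsto_atTop]
    intro ε hε
    obtain ⟨N, hN⟩ := exists_nat_gt (Lf * (12 * Real.sqrt (Fintype.card (Edge 3 L)) * r₀) / ε)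
    refine ⟨N, fun n hn => ?_⟩
    rw [Real.dist_eq]
    have h1 := happr n x
    have h2 : Lf * (12 * Real.sqrt (Fintype.card (Edge 3 L)) * (r₀ / ((n : ℝ) + 2))) < ε := by
      rw [show Lf * (12 * Real.sqrt (Fintype.card (Edge 3 L)) * (r₀ / ((n : ℝ) + 2))) = (Lf * (12 * Real.sqrt (Fintype.card (Edge 3 L)) * r₀)) / ((n : ℝ) + 2) by ring]
      rw [div_lt_iff₀ (by positivity)]
      have h3 := (div_lt_iff₀ hε).1 hN
      have h4 : (N : ℝ) ≤ n := by exact_mod_cast hn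
      nlinarith
    linarith
  have hrlim : Tendsto (fun n : ℕ => r₀ / ((n : ℝ) + 2)) atTop (𝓝 0) := by
    have h1 : Tendsto (fun n : ℕ => (n : ℝ) + 2) atTop atTop := tendsto_natCast_atTop_atTop.atTop_add tendsto_const_nhds
    exact h1.const_div_atTop r₀ |>.congr fun n => rfl
  -- uniform bounds
  have hgbd : ∀ (n : ℕ) (x : GaugeConfig 3 L (Matrix.specialUnitaryGroup (Fin 2) ℂ)), |g n (coords x)| ≤ MF + Lf * (12 * Real.sqrt (Fintype.card (Edge 3 L)) * r₀) := by
    intro n x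
    have h1 := happr n x; have h2 := hMF x
    have h3 : Lf * (12 * Real.sqrt (Fintype.card (Edge 3 L)) * (r₀ / ((n : ℝ) + 2))) ≤ Lf * (12 * Real.sqrt (Fintype.card (Edge 3 L)) * r₀) :=
      mul_le_mul_of_nonneg_left (mul_le_mul_of_nonneg_left (hrn n) (by positivity)) hLf
    have := abs_add_le (g n (coords x) - F x) (F x)
    rw [sub_add_cancel] at this
    linarith
  obtain ⟨B₀, hB₀⟩ : ∃ B₀ : ℝ, B₀ = MF + Lf * (12 * Real.sqrt (Fintype.card (Edge 3 L)) * r₀) := ⟨_, rfl⟩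
  rw [← hB₀] at hgbd
  have hgc : ∀ n : ℕ, Continuous fun x : GaugeConfig 3 L (Matrix.specialUnitaryGroup (Fin 2) ℂ) => g n (coords x) := fun n => (hg n).continuous.comp hco
  -- (i) `∫ g_n e^{g_n} → ∫ F e^F`
  have hlimA : Tendsto (fun n : ℕ => ∫ x, g n (coords x) * Real.exp (g n (coords x)) ∂μ) atTop (𝓝 (∫ x, F x * Real.exp (F x) ∂μ)) := by
    refine tendsto_integral_of_dominated_convergence (fun _ => B₀ * Real.exp B₀) (fun n => ((hgc n).mul (Real.continuous_exp.comp (hgc n))).aestronglyMeasurable)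
      (integrable_const _) (fun n => ae_of_all _ fun x => ?_) (ae_of_all _ fun x => ((hconv x).mul ((Real.continuous_exp.tendsto _).comp (hconv x))))
    rw [Real.norm_eq_abs, abs_mul, abs_of_pos (Real.exp_pos _)]
    exact mul_le_mul (hgbd n x) (Real.exp_le_exp.2 (le_abs_self _ |>.trans (hgbd n x))) (Real.exp_pos _).le ((abs_nonneg _).trans (hgbd n x))
  -- (ii) `Λ_n → Λ`
  have hlimΛ : Tendsto (fun n : ℕ => ∫ x, Real.exp (g n (coords x)) ∂μ) atTop (𝓝 (∫ x, Real.exp (F x) ∂μ)) := by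
    refine tendsto_integral_of_dominated_convergence (fun _ => Real.exp B₀) (fun n => (Real.continuous_exp.comp (hgc n)).aestronglyMeasurable)
      (integrable_const _) (fun n => ae_of_all _ fun x => ?_) (ae_of_all _ fun x => (Real.continuous_exp.tendsto _).comp (hconv x))
    rw [Real.norm_eq_abs, abs_of_pos (Real.exp_pos _)]
    exact Real.exp_le_exp.2 (le_abs_self _ |>.trans (hgbd n x))
  have hΛ0 : 0 < ∫ x, Real.exp (F x) ∂μ := by
    have hEi : Integrable (fun x => Real.exp (F x)) μ := (Real.continuous_exp.comp hFc).integrable_of_hasCompactSupport (HasCompactSupport.of_compactSpace _)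
    calc (0 : ℝ) < ∫ _x, Real.exp (-MF) ∂μ := by rw [integral_const, probReal_univ, one_smul]; exact Real.exp_pos _
      _ ≤ _ := integral_mono (integrable_const _) hEi fun x => Real.exp_le_exp.2 (abs_le.1 (hMF x)).1
  have hlimLHS : Tendsto (fun n : ℕ => ∫ x, g n (coords x) * Real.exp (g n (coords x)) ∂μ - (∫ x, Real.exp (g n (coords x)) ∂μ) * Real.log (∫ x, Real.exp (g n (coords x)) ∂μ)) atTop
      (𝓝 (∫ x, F x * Real.exp (F x) ∂μ - (∫ x, Real.exp (F x) ∂μ) * Real.log (∫ x, Real.exp (F x) ∂μ))) :=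
    hlimA.sub (hlimΛ.mul ((Real.continuousAt_log hΛ0.ne').tendsto.comp hlimΛ))
  -- (iii) the right-hand sides
  have hlimRHS : Tendsto (fun n : ℕ => (1 / (1 - 12 * |β'|)) / 2 * ∫ x, (G x / (1 - 2 * (r₀ / ((n : ℝ) + 2)))) ^ 2 * Real.exp (g n (coords x)) ∂μ) atTop
      (𝓝 ((1 / (1 - 12 * |β'|)) / 2 * ∫ x, (G x / (1 - 2 * 0)) ^ 2 * Real.exp (F x) ∂μ)) := by
    refine Tendsto.const_mul _ (tendsto_integral_of_dominated_convergence (fun _ => (M / (1 - 2 * r₀)) ^ 2 * Real.exp B₀)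
      (fun n => (((hGm.div_const _).pow_const 2).mul (Real.measurable_exp.comp (hgc n).measurable)).aestronglyMeasurable)
      (integrable_const _) (fun n => ae_of_all _ fun x => ?_) (ae_of_all _ fun x => ?_))
    · rw [Real.norm_eq_abs, abs_of_nonneg (mul_nonneg (sq_nonneg _) (Real.exp_pos _).le)]
      have h12 : 0 < 1 - 2 * (r₀ / ((n : ℝ) + 2)) := by linarith [hrn4 n]
      have h12' : 1 - 2 * r₀ ≤ 1 - 2 * (r₀ / ((n : ℝ) + 2)) := by linarith [hrn n]
      have hr2 : 0 < 1 - 2 * r₀ := by linarith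
      refine mul_le_mul ?_ (Real.exp_le_exp.2 (le_abs_self _ |>.trans (hgbd n x))) (Real.exp_pos _).le (sq_nonneg _)
      have hG0x : 0 ≤ G x / (1 - 2 * (r₀ / ((n : ℝ) + 2))) := div_nonneg (hG0 x) h12.le
      have hGx : G x / (1 - 2 * (r₀ / ((n : ℝ) + 2))) ≤ M / (1 - 2 * r₀) :=
        (div_le_div_of_nonneg_right (hGM x) h12.le).trans (div_le_div_of_nonneg_left ((hG0 x).trans (hGM x)) hr2 h12')
      exact pow_le_pow_left₀ hG0x hGx 2
    · exact (((tendsto_const_nhds.div (tendsto_const_nhds.sub (hrlim.const_mul 2)) (by norm_num)).pow 2).mul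
        ((Real.continuous_exp.tendsto _).comp (hconv x)))
  rw [mul_zero, sub_zero] at hlimRHS
  simp only [div_one] at hlimRHS
  exact le_of_tendsto_of_tendsto' hlimLHS hlimRHS hLSn

/-! ## §4. The dual `T₂` inequality and Talagrand's `T₂` for the Wilson–Gibbs measure -/

/-- ★★★ **Dual `T₂` for `μ_(β')`**: for `|β'| < 1/12`, every `L` and every `ρ_L`-Lipschitz `f : SU(2)^E → ℝ`:
`∫ exp(inf_v [f(v) + ρ_L(x,v)²/(2C)]) dμ_(β')(x) ≤ exp(∫ f dμ_(β'))` with `C = 1/(1 − 12|β'|)` (G69a–c on `(SU(2)^E, ρ_L)` with the LSI of §3).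
[cite: BakryGentilLedoux2014, Thm 9.6.1] [cite: ShenZhuZhu2022, §4 Corollary 4.4 (4.12)] -/
theorem wilson_integral_exp_hopfLax_le (L : ℕ) [NeZero L] (β' : ℝ) (hβ : |β'| < 1 / 12)
    {f : GaugeConfig 3 L (Matrix.specialUnitaryGroup (Fin 2) ℂ) → ℝ} {Lf : ℝ} (hLf : 0 ≤ Lf)
    (hlip : ∀ Q Q', |f Q' - f Q| ≤ Lf * Real.sqrt (torusRiemannDistSq (fundamentalLatticeRep 2) Q Q')) :
    ∫ x, Real.exp (⨅ v, (f v + torusRiemannDistSq (fundamentalLatticeRep 2) x v / (2 * (1 / (1 - 12 * |β'|))))) ∂(wilsonMeasure (d := 3) (L := L) (fundamentalRep (Fin 2)) β') ≤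
      Real.exp (∫ x, f x ∂(wilsonMeasure (d := 3) (L := L) (fundamentalRep (Fin 2)) β')) := by
  classical
  haveI := secondCountableTopology_su2
  haveI := borelSpace_config L
  haveI : IsProbabilityMeasure (wilsonMeasure (d := 3) (L := L) (fundamentalRep (Fin 2)) β') :=
    isProbabilityMeasure_wilsonMeasure (d := 3) (L := L) (fundamentalRep (Fin 2)) (continuous_fundamentalRep (Fin 2)) β'
  have hnn : ∀ u v : GaugeConfig 3 L (Matrix.specialUnitaryGroup (Fin 2) ℂ), 0 ≤ torusRiemannDistSq (fundamentalLatticeRep 2) u v := fun u v => by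
    unfold torusRiemannDistSq; exact Finset.sum_nonneg fun _ _ => sq_nonneg _
  have hzero : ∀ u v : GaugeConfig 3 L (Matrix.specialUnitaryGroup (Fin 2) ℂ), Real.sqrt (torusRiemannDistSq (fundamentalLatticeRep 2) u v) = 0 ↔ u = v := fun u v => by
    rw [Real.sqrt_eq_zero (hnn u v), torusRiemannDistSq_two_eq_zero_iff]
  have hself : ∀ u : GaugeConfig 3 L (Matrix.specialUnitaryGroup (Fin 2) ℂ), Real.sqrt (torusRiemannDistSq (fundamentalLatticeRep 2) u u) = 0 := fun u => (hzero u u).2 rfl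
  have hcomm : ∀ u v : GaugeConfig 3 L (Matrix.specialUnitaryGroup (Fin 2) ℂ), Real.sqrt (torusRiemannDistSq (fundamentalLatticeRep 2) u v) = Real.sqrt (torusRiemannDistSq (fundamentalLatticeRep 2) v u) :=
    fun u v => by rw [torusRiemannDistSq_two_comm]
  have htri : ∀ u v w : GaugeConfig 3 L (Matrix.specialUnitaryGroup (Fin 2) ℂ), Real.sqrt (torusRiemannDistSq (fundamentalLatticeRep 2) u w) ≤
      Real.sqrt (torusRiemannDistSq (fundamentalLatticeRep 2) u v) + Real.sqrt (torusRiemannDistSq (fundamentalLatticeRep 2) v w) :=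
    fun u v w => sqrt_torusRiemannDistSq_two_triangle u v w
  letI : MetricSpace (GaugeConfig 3 L (Matrix.specialUnitaryGroup (Fin 2) ℂ)) :=
    { __ := PseudoMetricSpace.ofDistTopology (fun u v : GaugeConfig 3 L (Matrix.specialUnitaryGroup (Fin 2) ℂ) => Real.sqrt (torusRiemannDistSq (fundamentalLatticeRep 2) u v))
        hself hcomm htri isOpen_iff_riemannDist_ball,
      eq_of_dist_eq_zero := fun {u v} huv => (hzero u v).1 huv }
  have hC : 0 < 1 / (1 - 12 * |β'|) := div_pos one_pos (by linarith)
  have hfc : Continuous f := continuous_of_riemannLipschitz hlip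
  have hlip' : ∀ z w : GaugeConfig 3 L (Matrix.specialUnitaryGroup (Fin 2) ℂ), |f z - f w| ≤ Lf * dist z w := fun z w => by
    have := hlip w z
    show |f z - f w| ≤ Lf * Real.sqrt (torusRiemannDistSq (fundamentalLatticeRep 2) z w)
    rw [hcomm]; exact this
  have h := integral_exp_hopfLax_le (wilsonMeasure (d := 3) (L := L) (fundamentalRep (Fin 2)) β') hC
    (fun F LF hLF hlipF R hR G M hG hG0 hGM hloc => wilson_logSobolev_exp_local L β' hβ hLF (fun Q Q' => hlipF Q Q') hR hG hG0 hGM hloc) hfc hLf hlip'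
  have hd2 : ∀ x v : GaugeConfig 3 L (Matrix.specialUnitaryGroup (Fin 2) ℂ), dist x v ^ 2 = torusRiemannDistSq (fundamentalLatticeRep 2) x v := fun x v => by
    show Real.sqrt (torusRiemannDistSq (fundamentalLatticeRep 2) x v) ^ 2 = _
    exact Real.sq_sqrt (hnn x v)
  simp only [hd2] at h
  exact h

/-- ★★★★ **Talagrand's `T₂` inequality for the `SU(2)` Wilson–Gibbs measure, uniformly in the volume.**  For `|β'| < 1/12`, every `L` and every
probability measure `ν` on `SU(2)^E` with `KL(ν‖μ_(β')) < ∞`: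
`szzWassersteinSq ρ_L² ν μ_(β') ≤ ofReal((2/(1 − 12|β'|))·KL(ν‖μ_(β')))` — i.e. `W₂^{ρ_L}(ν, μ_(β'))² ≤ (2/(1−12|β'|))·KL(ν‖μ_(β'))` with an optimal
coupling (Otto–Villani from the volume-uniform log-Sobolev inequality; G69d). [cite: BakryGentilLedoux2014, Thm 9.6.1] [cite: ShenZhuZhu2022, §4 Corollary 4.4 (4.12)] -/
theorem wilson_talagrand_T2 (L : ℕ) [NeZero L] (β' : ℝ) (hβ : |β'| < 1 / 12)
    (ν : Measure (GaugeConfig 3 L (Matrix.specialUnitaryGroup (Fin 2) ℂ))) [IsProbabilityMeasure ν]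
    (hfin : klDiv ν (wilsonMeasure (d := 3) (L := L) (fundamentalRep (Fin 2)) β') ≠ ∞) :
    szzWassersteinSq (torusRiemannDistSq (fundamentalLatticeRep 2)) ν (wilsonMeasure (d := 3) (L := L) (fundamentalRep (Fin 2)) β') ≤
      ENNReal.ofReal (2 * (1 / (1 - 12 * |β'|)) * (klDiv ν (wilsonMeasure (d := 3) (L := L) (fundamentalRep (Fin 2)) β')).toReal) := by
  classical
  haveI := secondCountableTopology_su2
  haveI := borelSpace_config L
  haveI : IsProbabilityMeasure (wilsonMeasure (d := 3) (L := L) (fundamentalRep (Fin 2)) β') :=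
    isProbabilityMeasure_wilsonMeasure (d := 3) (L := L) (fundamentalRep (Fin 2)) (continuous_fundamentalRep (Fin 2)) β'
  have hnn : ∀ u v : GaugeConfig 3 L (Matrix.specialUnitaryGroup (Fin 2) ℂ), 0 ≤ torusRiemannDistSq (fundamentalLatticeRep 2) u v := fun u v => by
    unfold torusRiemannDistSq; exact Finset.sum_nonneg fun _ _ => sq_nonneg _
  have hzero : ∀ u v : GaugeConfig 3 L (Matrix.specialUnitaryGroup (Fin 2) ℂ), Real.sqrt (torusRiemannDistSq (fundamentalLatticeRep 2) u v) = 0 ↔ u = v := fun u v => by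
    rw [Real.sqrt_eq_zero (hnn u v), torusRiemannDistSq_two_eq_zero_iff]
  have hself : ∀ u : GaugeConfig 3 L (Matrix.specialUnitaryGroup (Fin 2) ℂ), Real.sqrt (torusRiemannDistSq (fundamentalLatticeRep 2) u u) = 0 := fun u => (hzero u u).2 rfl
  have hcomm : ∀ u v : GaugeConfig 3 L (Matrix.specialUnitaryGroup (Fin 2) ℂ), Real.sqrt (torusRiemannDistSq (fundamentalLatticeRep 2) u v) = Real.sqrt (torusRiemannDistSq (fundamentalLatticeRep 2) v u) :=
    fun u v => by rw [torusRiemannDistSq_two_comm]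
  have htri : ∀ u v w : GaugeConfig 3 L (Matrix.specialUnitaryGroup (Fin 2) ℂ), Real.sqrt (torusRiemannDistSq (fundamentalLatticeRep 2) u w) ≤
      Real.sqrt (torusRiemannDistSq (fundamentalLatticeRep 2) u v) + Real.sqrt (torusRiemannDistSq (fundamentalLatticeRep 2) v w) :=
    fun u v w => sqrt_torusRiemannDistSq_two_triangle u v w
  letI : MetricSpace (GaugeConfig 3 L (Matrix.specialUnitaryGroup (Fin 2) ℂ)) :=
    { __ := PseudoMetricSpace.ofDistTopology (fun u v : GaugeConfig 3 L (Matrix.specialUnitaryGroup (Fin 2) ℂ) => Real.sqrt (torusRiemannDistSq (fundamentalLatticeRep 2) u v))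
        hself hcomm htri isOpen_iff_riemannDist_ball,
      eq_of_dist_eq_zero := fun {u v} huv => (hzero u v).1 huv }
  have hC : 0 < 1 / (1 - 12 * |β'|) := div_pos one_pos (by linarith)
  have hd2 : ∀ x v : GaugeConfig 3 L (Matrix.specialUnitaryGroup (Fin 2) ℂ), dist x v ^ 2 = torusRiemannDistSq (fundamentalLatticeRep 2) x v := fun x v => by
    show Real.sqrt (torusRiemannDistSq (fundamentalLatticeRep 2) x v) ^ 2 = _
    exact Real.sq_sqrt (hnn x v)
  have hdual : ∀ (f : GaugeConfig 3 L (Matrix.specialUnitaryGroup (Fin 2) ℂ) → ℝ) (Lf : ℝ), Continuous f → 0 ≤ Lf → (∀ z w, |f z - f w| ≤ Lf * dist z w) →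
      ∫ x, Real.exp (⨅ v, (f v + dist x v ^ 2 / (2 * (1 / (1 - 12 * |β'|))))) ∂(wilsonMeasure (d := 3) (L := L) (fundamentalRep (Fin 2)) β') ≤
        Real.exp (∫ x, f x ∂(wilsonMeasure (d := 3) (L := L) (fundamentalRep (Fin 2)) β')) := by
    intro f Lf _ hLf hlipf
    have hlip2 : ∀ Q Q' : GaugeConfig 3 L (Matrix.specialUnitaryGroup (Fin 2) ℂ), |f Q' - f Q| ≤ Lf * Real.sqrt (torusRiemannDistSq (fundamentalLatticeRep 2) Q Q') := fun Q Q' => by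
      have := hlipf Q' Q
      rw [hcomm]; exact this
    have h := wilson_integral_exp_hopfLax_le L β' hβ hLf hlip2
    simp only [← hd2] at h
    exact h
  have h := szzWassersteinSq_le_klDiv_of_dual (wilsonMeasure (d := 3) (L := L) (fundamentalRep (Fin 2)) β') hC hdual ν hfin
  have hcost : (fun x y : GaugeConfig 3 L (Matrix.specialUnitaryGroup (Fin 2) ℂ) => dist x y ^ 2) = torusRiemannDistSq (fundamentalLatticeRep 2) := by
    funext x y; exact hd2 x y
  rw [hcost] at h
  exact h

end Summit.QuantumFields.YangMills.Theorems.ColdStartUniversality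

end
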